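import Summits.QuantumFields.YangMills.Theorems.BalabanLadderNTMarkovMirrorDefectResponseMoments
import Summits.QuantumFields.YangMills.Theorems.BalabanLadderNTStrongCouplingInfluence
import HarnessLib

/-!
# Route `FiniteRankMirror`, glue item `DefectPeelingGlue` (stmt-QuantumFields-23849) — preparation

Helper file (`--supports stmt-QuantumFields-23849`; fleet lead prover of crux `NT`, unit `ym-spine-19353-p1`, g22) for the
glue `FemtoResponseLaw → MirrorPeeling → MirrorDefectVanishes` (LINE g9-1b «Markov peeling» of ideator ym-idea-8).  The
Markov–mirror series (`…NTMarkovMirrorDefectResponseMoments`, `…BareTypicalPackage`) takes a positive-time cube family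
`Q_β` carrying the lattice support of `v(aβ·)` as a HYPOTHESIS; here it is CONSTRUCTED, and the second peeling factor
`‖kerE_Q(Ṽ) − p_V‖₂` is bounded uniformly in the spacing.

* §1 `exists_posTimeCube`, `exists_posTimeCubeFamily` — for `v` vanishing outside `B(0, ℓ₃)` and below the time `δ > 0`:
  the cube with corner `(1, −N, −N, −N)` and side `2N+2`, `N = ⌈(ℓ₃ + δ/2)/s⌉₊ + 2`, sits at times `≥ 1`, has physical
  size `≤ 3(ℓ₃ + δ/2) + 14` and `b·s ≤ 2(ℓ₃ + δ/2) + 8s` (femto), and carries the support at depth `≥ 2` and its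
  `e₀`-thickening at depth `≥ (δ/2)/s`, as soon as `s ≤ min 1 (δ/6)`;
* §2 `smear_response_sq_le` — per-site mean-square plane laws `≤ h²` on the support give
  `E_T[(kerE_Q(Ṽ) − p_V)²] ≤ (N·K·6h)²` (Cauchy–Schwarz over the `≤ 6N` terms; companion of `defect_response_sq_le`);
  `smear_response_sq_le_uniform` — with the typical law `h = C₁/depth⁴ ≤ C₁(s/κ)⁴` and `N ≤ (7M/s)⁴` support sites the
  bound `(6·7⁴·K·C₁·M⁴/κ⁴)²` is uniform in `s`.

HONEST FRAMING: lattice bookkeeping (geometry of cubes, Cauchy–Schwarz, linearity of the cube kernel); nothing of (RM),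
`FemtoResponseMoments`, NT or the mass gap is proved here; no summit is proved by this line; not Clay.
-/

set_option autoImplicit false

noncomputable section

open scoped SchwartzMap
open MeasureTheory Filter Topology
open Literature.MathematicalPhysics.QuantumFieldTheory Literature.MathematicalPhysics.QuantumLattice
open Literature.Probability.LatticeModels
open Summit.QuantumFields.YangMills.Cruxes.OSLegsFromFemtoAndGap.DlrCollarTransfer
open Summit.QuantumFields.YangMills.Cruxes.OSLegsFromFemtoAndGap.DlrCollarTransfer.StubLower (mem_cubeSites_iff)
open Summit.QuantumFields.YangMills.Cruxes.NT.Reference (eventually_le_of_tendsto div_pow_depth_le continuous_kerE)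
open Summit.QuantumFields.YangMills.Cruxes.UVSeamRec.UnitTransfer
  (exists_radius norm_le_div_of_smul_siteToE mem_box_of_norm_le smul_siteToE_apply_zero)
open Summit.QuantumFields.YangMills.Cruxes.NT.MarkovMirror
  (kerE_finset_sum_mul dens_eq_sum_subtype_plane torusE_mono torusE_finset_sum torusE_const_mul
    mem_box_of_thickSupport)
open Summit.QuantumFields.YangMills.Cruxes.NT.StrongCoupling (succ_le_depth_of_window)

namespace Summit.QuantumFields.YangMills.Cruxes.FiniteRankMirrorDefectPeeling

/-! ## §1 Geometry: a positive-time femto cube around the lattice support of `v(s·)` -/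

section Geometry

/-- Coordinates of a site whose smeared position at scale `s > 0` is a point where `v ≠ 0`, for a `v` supported in
the ball of radius `ℓ₃` at times `≥ 2κ`: `2κ/s ≤ z 0` and `|z j| ≤ ℓ₃/s`. [folklore] -/
theorem coords_of_apply_ne_zero {v : EuclideanSpace ℝ (Fin 4) → ℝ} {s ℓ₃ κ : ℝ} (hs : 0 < s)
    (hvB : ∀ z, v z ≠ 0 → ‖z‖ ≤ ℓ₃) (hvT : ∀ z, v z ≠ 0 → 2 * κ ≤ z 0)
    {z : Fin 4 → ℤ} (hz : v (s • siteToE z) ≠ 0) :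
    2 * κ / s ≤ (z 0 : ℝ) ∧ ∀ j, |((z j : ℤ) : ℝ)| ≤ ℓ₃ / s := by
  constructor
  · have h := hvT _ hz
    rw [smul_siteToE_apply_zero] at h
    rw [div_le_iff₀ hs]
    linarith
  · intro j
    have h := norm_le_div_of_smul_siteToE hs z (hvB _ hz)
    have hj : ‖z j‖ ≤ ‖z‖ := norm_le_pi_norm z j
    rw [Int.norm_eq_abs] at hj
    exact hj.trans h

/-- **A positive-time femto cube around the thickened lattice support, at one spacing.**  Let `v` vanish outside the
ball of radius `ℓ₃ ≥ 0` and below the time `2κ` (`κ > 0`), and let `0 < s ≤ 1` with `3s ≤ κ`.  Then there is a cube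
`Q = (c, b)` at times `≥ 1`, of physical size `(|c j| + b + 3)·s ≤ 3(ℓ₃ + κ) + 14` and `b·s ≤ 2(ℓ₃ + κ) + 8s`,
containing every site `x` of the lattice support of `v(s·)` at depth `≥ 2` and every site of its `e₀`-thickening
(`v(s·x) ≠ 0 ∨ v(s·(x + e₀)) ≠ 0`) at depth `≥ κ/s`.  (Corner `(1, −N, −N, −N)`, side `2N + 2`,
`N = ⌈(ℓ₃ + κ)/s⌉₊ + 2`.) [folklore] -/
theorem exists_posTimeCube (v : EuclideanSpace ℝ (Fin 4) → ℝ) {s ℓ₃ κ : ℝ} (hs : 0 < s) (hs1 : s ≤ 1)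
    (hℓ₃ : 0 ≤ ℓ₃) (hκ : 0 < κ) (hsκ : 3 * s ≤ κ)
    (hvB : ∀ z, v z ≠ 0 → ‖z‖ ≤ ℓ₃) (hvT : ∀ z, v z ≠ 0 → 2 * κ ≤ z 0) :
    ∃ (c : Fin 4 → ℤ) (b : ℕ), 1 ≤ c 0 ∧ (∀ j : Fin 4, (|((c j : ℤ) : ℝ)| + (b : ℝ) + 3) * s ≤ 3 * (ℓ₃ + κ) + 14) ∧
      (b : ℝ) * s ≤ 2 * (ℓ₃ + κ) + 8 * s ∧
      (∀ x : Fin 4 → ℤ, v (s • siteToE x) ≠ 0 → x ∈ cubeSites c b ∧ 2 ≤ depth c b x) ∧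
      (∀ x : Fin 4 → ℤ, (v (s • siteToE x) ≠ 0 ∨ v (s • siteToE (x + Pi.single 0 1)) ≠ 0) →
        x ∈ cubeSites c b ∧ κ / s ≤ (depth c b x : ℝ)) := by
  set N : ℕ := ⌈(ℓ₃ + κ) / s⌉₊ + 2 with hN
  set n : ℕ := ⌈κ / s⌉₊ with hn
  have hks : 0 < κ / s := div_pos hκ hs
  have hks3 : 3 ≤ κ / s := by rw [le_div_iff₀ hs]; linarith
  have hn_le : κ / s ≤ (n : ℝ) := Nat.le_ceil _
  have hn_lt : (n : ℝ) < κ / s + 1 := Nat.ceil_lt_add_one hks.le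
  have hn1 : 1 ≤ n := by
    have : 0 < n := Nat.ceil_pos.2 hks
    omega
  have hN_le : (ℓ₃ + κ) / s ≤ ((⌈(ℓ₃ + κ) / s⌉₊ : ℕ) : ℝ) := Nat.le_ceil _
  have hN_lt : ((⌈(ℓ₃ + κ) / s⌉₊ : ℕ) : ℝ) < (ℓ₃ + κ) / s + 1 := Nat.ceil_lt_add_one (by positivity)
  have hNR : (N : ℝ) = ((⌈(ℓ₃ + κ) / s⌉₊ : ℕ) : ℝ) + 2 := by rw [hN]; push_cast; ring
  have hℓκs : 0 ≤ (ℓ₃ + κ) / s := by positivity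
  have hℓs : ℓ₃ / s ≤ (ℓ₃ + κ) / s := by gcongr; linarith
  -- the cube and the window of half-width `n` around every site of the thickened support
  set c₀ : Fin 4 → ℤ := fun j => if j = 0 then 1 else -(N : ℤ) with hc₀
  set b₀ : ℕ := 2 * N + 2 with hb₀
  have hc₀0 : c₀ 0 = 1 := by simp [hc₀]
  have hc₀j : ∀ j : Fin 4, j ≠ 0 → c₀ j = -(N : ℤ) := fun j hj => by simp [hc₀, hj]
  have key : ∀ x : Fin 4 → ℤ, (v (s • siteToE x) ≠ 0 ∨ v (s • siteToE (x + Pi.single 0 1)) ≠ 0) →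
      ∀ j, c₀ j + n ≤ x j ∧ x j + n + 1 ≤ c₀ j + b₀ := by
    intro x hx
    -- coordinates of `x`: `2κ/s − 1 ≤ x 0 ≤ ℓ₃/s`, `|x j| ≤ ℓ₃/s` for `j ≠ 0`
    have hcoord : 2 * κ / s - 1 ≤ (x 0 : ℝ) ∧ (x 0 : ℝ) ≤ ℓ₃ / s ∧
        ∀ j : Fin 4, j ≠ 0 → |((x j : ℤ) : ℝ)| ≤ ℓ₃ / s := by
      rcases hx with h | h
      · obtain ⟨h0, hj⟩ := coords_of_apply_ne_zero hs hvB hvT h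
        exact ⟨by linarith, (le_abs_self _).trans (hj 0), fun j _ => hj j⟩
      · obtain ⟨h0, hj⟩ := coords_of_apply_ne_zero hs hvB hvT h
        have e0 : ((((x + Pi.single (0 : Fin 4) (1 : ℤ) : Fin 4 → ℤ)) 0 : ℤ) : ℝ) = (x 0 : ℝ) + 1 := by
          simp
        have ej : ∀ j : Fin 4, j ≠ 0 → ((((x + Pi.single (0 : Fin 4) (1 : ℤ) : Fin 4 → ℤ)) j : ℤ) : ℝ) = (x j : ℝ) := by
          intro j hj; simp [hj]
        refine ⟨by rw [e0] at h0; linarith, ?_, fun j hj' => by rw [← ej j hj']; exact hj j⟩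
        have := (le_abs_self _).trans (hj 0)
        rw [e0] at this; linarith
    obtain ⟨hx0lo, hx0hi, hxj⟩ := hcoord
    have e2 : 2 * κ / s = 2 * (κ / s) := by ring
    have esplit : (ℓ₃ + κ) / s = ℓ₃ / s + κ / s := add_div _ _ _
    have hℓs0 : 0 ≤ ℓ₃ / s := div_nonneg hℓ₃ hs.le
    intro j
    by_cases hj : j = 0
    · subst hj
      have h1 : (1 : ℝ) + n ≤ (x 0 : ℝ) := by linarith
      have h2 : (x 0 : ℝ) + n + 1 ≤ 1 + (2 * (N : ℝ) + 2) := by rw [hNR]; linarith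
      rw [hc₀0, hb₀]
      constructor
      · exact_mod_cast h1
      · push_cast; exact_mod_cast h2
    · have ha := abs_le.1 (hxj j hj)
      have h1 : -(N : ℝ) + n ≤ (x j : ℝ) := by rw [hNR]; linarith
      have h2 : (x j : ℝ) + n + 1 ≤ -(N : ℝ) + (2 * (N : ℝ) + 2) := by rw [hNR]; linarith
      rw [hc₀j j hj, hb₀]
      constructor
      · exact_mod_cast h1
      · push_cast; exact_mod_cast h2
  have hmem : ∀ x : Fin 4 → ℤ, (v (s • siteToE x) ≠ 0 ∨ v (s • siteToE (x + Pi.single 0 1)) ≠ 0) →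
      x ∈ cubeSites c₀ b₀ ∧ n + 1 ≤ depth c₀ b₀ x := by
    intro x hx
    refine ⟨(mem_cubeSites_iff _ _ _).2 fun j => ?_, succ_le_depth_of_window (key x hx)⟩
    have := key x hx j; constructor <;> omega
  have hNs : (N : ℝ) * s ≤ (ℓ₃ + κ) + 3 * s := by
    have := mul_le_mul_of_nonneg_right hN_lt.le hs.le
    have e : ((ℓ₃ + κ) / s + 1) * s = (ℓ₃ + κ) + s := by field_simp
    rw [hNR]; nlinarith [e, this]
  refine ⟨c₀, b₀, by rw [hc₀0], fun j => ?_, by rw [hb₀]; push_cast; nlinarith [hNs], ?_, ?_⟩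
  · -- physical size
    have hcj : |((c₀ j : ℤ) : ℝ)| ≤ N := by
      by_cases hj : j = 0
      · subst hj
        have : (2 : ℝ) ≤ N := by rw [hNR]; linarith [Nat.cast_nonneg (α := ℝ) ⌈(ℓ₃ + κ) / s⌉₊]
        rw [hc₀0]; simp only [Int.cast_one, abs_one]; linarith
      · rw [hc₀j j hj]; simp
    have h1 : (|((c₀ j : ℤ) : ℝ)| + (b₀ : ℝ) + 3) ≤ 3 * N + 5 := by rw [hb₀]; push_cast; linarith
    exact (mul_le_mul_of_nonneg_right h1 hs.le).trans (by nlinarith [hNs])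
  · -- support sites at depth `≥ 2`
    intro x hx
    obtain ⟨hxc, hd⟩ := hmem x (Or.inl hx)
    exact ⟨hxc, le_trans (by omega) hd⟩
  · -- thickened support at depth `≥ κ/s`
    intro x hx
    obtain ⟨hxc, hd⟩ := hmem x hx
    have : ((n + 1 : ℕ) : ℝ) ≤ (depth c₀ b₀ x : ℝ) := by exact_mod_cast hd
    exact ⟨hxc, by push_cast at this; linarith⟩

/-- **A positive-time femto cube FAMILY along a unit map.**  `a > 0` with `a → 0`; `v` vanishing outside the ball of
radius `ℓ₃ > 0` and below the time `δ > 0`.  Eventually in `β` (once `aβ ≤ min 1 (δ/6)`): cubes `Q_β = (c β, b β)` at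
times `≥ 1`, of physical size `(|c β j| + b β + 3)·aβ ≤ 3(ℓ₃ + δ/2) + 14`, with `b β · aβ ≤ 2(ℓ₃ + δ/2) + 8aβ`, carrying
the lattice support of `v(aβ·)` at depth `≥ 2` and its `e₀`-thickening at depth `≥ (δ/2)/aβ` (`exists_posTimeCube`
coupling by coupling). [folklore] -/
theorem exists_posTimeCubeFamily (a : ℝ → ℝ) (ha₀ : ∀ β, 0 < a β) (ha : Tendsto a atTop (𝓝 0))
    (v : EuclideanSpace ℝ (Fin 4) → ℝ) {ℓ₃ δ : ℝ} (hℓ₃ : 0 < ℓ₃) (hδ : 0 < δ)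
    (hvB : ∀ z, v z ≠ 0 → ‖z‖ ≤ ℓ₃) (hvT : ∀ z, v z ≠ 0 → δ ≤ z 0) :
    ∃ (β₅ : ℝ) (c : ℝ → (Fin 4 → ℤ)) (b : ℝ → ℕ),
      (∀ β, β₅ ≤ β → a β ≤ 1 ∧ a β ≤ δ / 6) ∧
      (∀ β, β₅ ≤ β → 1 ≤ c β 0 ∧
        ∀ j : Fin 4, (|((c β j : ℤ) : ℝ)| + (b β : ℝ) + 3) * a β ≤ 3 * (ℓ₃ + δ / 2) + 14) ∧
      (∀ β, β₅ ≤ β → (b β : ℝ) * a β ≤ 2 * (ℓ₃ + δ / 2) + 8 * a β) ∧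
      (∀ β, β₅ ≤ β → ∀ x : Fin 4 → ℤ, v (a β • siteToE x) ≠ 0 →
        x ∈ cubeSites (c β) (b β) ∧ 2 ≤ depth (c β) (b β) x) ∧
      (∀ β, β₅ ≤ β → ∀ x : Fin 4 → ℤ,
        (v (a β • siteToE x) ≠ 0 ∨ v (a β • siteToE (x + Pi.single 0 1)) ≠ 0) →
          x ∈ cubeSites (c β) (b β) ∧ (δ / 2) / a β ≤ (depth (c β) (b β) x : ℝ)) := by
  have hvT' : ∀ z, v z ≠ 0 → 2 * (δ / 2) ≤ z 0 := fun z hz => by linarith [hvT z hz]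
  -- coupling by coupling, when the spacing is admissible
  have H : ∀ β : ℝ, ∃ (c : Fin 4 → ℤ) (b : ℕ), (a β ≤ 1 ∧ a β ≤ δ / 6) →
      1 ≤ c 0 ∧ (∀ j : Fin 4, (|((c j : ℤ) : ℝ)| + (b : ℝ) + 3) * a β ≤ 3 * (ℓ₃ + δ / 2) + 14) ∧
      (b : ℝ) * a β ≤ 2 * (ℓ₃ + δ / 2) + 8 * a β ∧
      (∀ x : Fin 4 → ℤ, v (a β • siteToE x) ≠ 0 → x ∈ cubeSites c b ∧ 2 ≤ depth c b x) ∧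
      (∀ x : Fin 4 → ℤ, (v (a β • siteToE x) ≠ 0 ∨ v (a β • siteToE (x + Pi.single 0 1)) ≠ 0) →
        x ∈ cubeSites c b ∧ (δ / 2) / a β ≤ (depth c b x : ℝ)) := by
    intro β
    by_cases h : a β ≤ 1 ∧ a β ≤ δ / 6
    · obtain ⟨c, b, h1, h2, h3, h4, h5⟩ := exists_posTimeCube v (ha₀ β) h.1 hℓ₃.le (half_pos hδ)
        (by linarith [h.2]) hvB hvT'
      exact ⟨c, b, fun _ => ⟨h1, h2, h3, h4, h5⟩⟩
    · exact ⟨fun _ => 0, 0, fun h' => absurd h' h⟩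
  choose c b hcb using H
  obtain ⟨β₅, hβ₅⟩ := eventually_le_of_tendsto ha (show 0 < min 1 (δ / 6) from lt_min one_pos (by positivity))
  have hadm : ∀ β, β₅ ≤ β → a β ≤ 1 ∧ a β ≤ δ / 6 := fun β hβ =>
    ⟨(hβ₅ β hβ).trans (min_le_left _ _), (hβ₅ β hβ).trans (min_le_right _ _)⟩
  exact ⟨β₅, c, b, hadm, fun β hβ => ⟨(hcb β (hadm β hβ)).1, (hcb β (hadm β hβ)).2.1⟩,
    fun β hβ => (hcb β (hadm β hβ)).2.2.1, fun β hβ => (hcb β (hadm β hβ)).2.2.2.1,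
    fun β hβ => (hcb β (hadm β hβ)).2.2.2.2⟩

end Geometry

/-! ## §2 The mean-square response of the smearing `kerE_Q(Ṽ)` under per-site mean-square plane laws -/

section Smear

variable (G : Type) [Group G] [TopologicalSpace G] [IsTopologicalGroup G] [CompactSpace G]
  [MeasurableSpace G] [BorelSpace G] (r : LatticeRep G)

/-- **The response of the smearing is small in MEAN SQUARE under per-site mean-square plane laws** — the companion
of `MarkovMirror.defect_response_sq_le` for `Ṽ = ∑_y v(s·y) dens_y` itself (all six orientations, no summation by
parts).  With the reference value `p_V := ∑_y v(s·y) ∑_q p_q`: if on the torus `2L+1`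
`E_T[(kerE_Q^{lift U}(plane_q y) − p_q)²] ≤ h²` for every `q` at every site `y ∈ Q` where `v(s·y) ≠ 0`, `|v(s·y)| ≤ K`,
and there are at most `N` such sites, then `E_T[(kerE_Q^{lift U}(Ṽ) − p_V)²] ≤ (N · (K · (6 h)))²`. [folklore] -/
theorem smear_response_sq_le (β : ℝ) (c : Fin 4 → ℤ) (b L : ℕ) (s : ℝ) (v : 𝓢(EuclideanSpace ℝ (Fin 4), ℝ))
    (pq : {q : Fin 4 × Fin 4 // q.1 < q.2} → ℝ) {h K : ℝ}
    (hBL2 : ∀ q : {q : Fin 4 × Fin 4 // q.1 < q.2}, ∀ y ∈ cubeSites c b, v (s • siteToE y) ≠ 0 →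
      torusE G r β L (fun V => (kerE G r β c b V (plane G r q.1 y) - pq q) ^ 2) ≤ h ^ 2)
    (hK : ∀ y : Fin 4 → ℤ, |v (s • siteToE y)| ≤ K)
    (N : ℕ) (hN : ((cubeSites c b).filter fun y => v (s • siteToE y) ≠ 0).card ≤ N) :
    torusE G r β L (fun V => (kerE G r β c b V (fun V => ∑ y ∈ cubeSites c b, v (s • siteToE y) * dens G r y V) -
        ∑ y ∈ cubeSites c b, v (s • siteToE y) * ∑ q : {q : Fin 4 × Fin 4 // q.1 < q.2}, pq q) ^ 2) ≤
      (N * (K * (6 * h))) ^ 2 := by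
  classical
  obtain ⟨CA, hCA⟩ := exists_abs_plane_le r
  set T := (cubeSites c b).filter fun y => v (s • siteToE y) ≠ 0 with hT
  -- the centred responses
  set e : {q : Fin 4 × Fin 4 // q.1 < q.2} → (Fin 4 → ℤ) → LGConfig 4 G → ℝ := fun q y V =>
    kerE G r β c b V (plane G r q.1 y) - pq q with he
  have hcard6 : (Fintype.card {q : Fin 4 × Fin 4 // q.1 < q.2} : ℝ) = 6 := by
    have : Fintype.card {q : Fin 4 × Fin 4 // q.1 < q.2} = 6 := by decide
    rw [this]; norm_num
  have hec : ∀ (q : {q : Fin 4 × Fin 4 // q.1 < q.2}) (y : Fin 4 → ℤ), Continuous fun V => e q y V := fun q y =>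
    (continuous_kerE G r β c b (continuous_plane r q.1 y) (hCA q.1 y)).sub continuous_const
  -- (1) the response minus its reference value, as a sum over the support (pointwise in the exterior)
  have hD : ∀ V : LGConfig 4 G,
      kerE G r β c b V (fun V => ∑ y ∈ cubeSites c b, v (s • siteToE y) * dens G r y V) -
        ∑ y ∈ cubeSites c b, v (s • siteToE y) * ∑ q : {q : Fin 4 × Fin 4 // q.1 < q.2}, pq q =
      ∑ y ∈ T, v (s • siteToE y) * ∑ q : {q : Fin 4 × Fin 4 // q.1 < q.2}, e q y V := by
    intro V
    rw [kerE_finset_sum_mul G r β c b V _ _ _ (fun y _ => continuous_dens r y)]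
    have hinD : ∀ y : Fin 4 → ℤ, kerE G r β c b V (dens G r y) =
        ∑ q : {q : Fin 4 × Fin 4 // q.1 < q.2}, kerE G r β c b V (plane G r q.1 y) := by
      intro y
      have h := kerE_finset_sum_mul G r β c b V Finset.univ (fun _ => (1 : ℝ))
        (fun q : {q : Fin 4 × Fin 4 // q.1 < q.2} => plane G r q.1 y) fun q _ => continuous_plane r _ _
      simp only [one_mul] at h
      rw [← h]
      congr 1
      funext U
      exact dens_eq_sum_subtype_plane G r y U
    simp only [hinD]
    rw [← Finset.sum_sub_distrib]
    have hterm : ∀ y ∈ cubeSites c b,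
        v (s • siteToE y) * ∑ q : {q : Fin 4 × Fin 4 // q.1 < q.2}, kerE G r β c b V (plane G r q.1 y) -
          v (s • siteToE y) * ∑ q : {q : Fin 4 × Fin 4 // q.1 < q.2}, pq q =
        v (s • siteToE y) * ∑ q : {q : Fin 4 × Fin 4 // q.1 < q.2}, e q y V := by
      intro y _
      rw [← mul_sub, ← Finset.sum_sub_distrib]
    rw [Finset.sum_congr rfl hterm, ← Finset.sum_filter_add_sum_filter_not (cubeSites c b)
      (fun y => v (s • siteToE y) ≠ 0)]
    have hzero : ∑ y ∈ (cubeSites c b).filter (fun y => ¬(v (s • siteToE y) ≠ 0)),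
        v (s • siteToE y) * ∑ q : {q : Fin 4 × Fin 4 // q.1 < q.2}, e q y V = 0 := by
      refine Finset.sum_eq_zero fun y hy => ?_
      obtain ⟨-, hy⟩ := Finset.mem_filter.1 hy
      push Not at hy
      rw [hy, zero_mul]
    rw [hzero, add_zero]
  -- (2) pointwise Cauchy–Schwarz: `(…)² ≤ 6·#T·K²·Σ_{y∈T} Σ_q e²`
  have hpt : ∀ V : LGConfig 4 G,
      (∑ y ∈ T, v (s • siteToE y) * ∑ q : {q : Fin 4 × Fin 4 // q.1 < q.2}, e q y V) ^ 2 ≤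
      6 * T.card * K ^ 2 * ∑ y ∈ T, ∑ q : {q : Fin 4 × Fin 4 // q.1 < q.2}, e q y V ^ 2 := by
    intro V
    have h1 := sq_sum_le_card_mul_sum_sq (s := T)
      (f := fun y => v (s • siteToE y) * ∑ q : {q : Fin 4 × Fin 4 // q.1 < q.2}, e q y V)
    refine h1.trans ?_
    rw [Finset.mul_sum, Finset.mul_sum]
    refine Finset.sum_le_sum fun y _ => ?_
    have h2 := sq_sum_le_card_mul_sum_sq (s := (Finset.univ : Finset {q : Fin 4 × Fin 4 // q.1 < q.2}))
      (f := fun q => e q y V)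
    rw [Finset.card_univ, hcard6] at h2
    have hΔ : (v (s • siteToE y)) ^ 2 ≤ K ^ 2 := by
      rw [← sq_abs]; exact pow_le_pow_left₀ (abs_nonneg _) (hK y) 2
    calc (T.card : ℝ) * ((v (s • siteToE y) * ∑ q : {q : Fin 4 × Fin 4 // q.1 < q.2}, e q y V) ^ 2)
        = T.card * ((v (s • siteToE y)) ^ 2 * (∑ q : {q : Fin 4 × Fin 4 // q.1 < q.2}, e q y V) ^ 2) := by ring
      _ ≤ T.card * (K ^ 2 * (6 * ∑ q : {q : Fin 4 × Fin 4 // q.1 < q.2}, e q y V ^ 2)) := by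
          refine mul_le_mul_of_nonneg_left ?_ (Nat.cast_nonneg _)
          exact mul_le_mul hΔ h2 (sq_nonneg _) (sq_nonneg _)
      _ = 6 * T.card * K ^ 2 * ∑ q : {q : Fin 4 × Fin 4 // q.1 < q.2}, e q y V ^ 2 := by ring
  -- (3) the per-site mean-square laws
  have hterm2 : ∀ y ∈ T, ∀ q : {q : Fin 4 × Fin 4 // q.1 < q.2}, torusE G r β L (fun V => e q y V ^ 2) ≤ h ^ 2 := by
    intro y hy q
    obtain ⟨hyc, hyv⟩ := Finset.mem_filter.1 hy
    exact hBL2 q y hyc hyv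
  -- (4) integrate
  have hDc : Continuous fun V => ∑ y ∈ T, v (s • siteToE y) * ∑ q : {q : Fin 4 × Fin 4 // q.1 < q.2}, e q y V :=
    continuous_finsetSum _ fun y _ => continuous_const.mul (continuous_finsetSum _ fun q _ => hec q y)
  have hRc : Continuous fun V => 6 * (T.card : ℝ) * K ^ 2 *
      ∑ y ∈ T, ∑ q : {q : Fin 4 × Fin 4 // q.1 < q.2}, e q y V ^ 2 :=
    continuous_const.mul (continuous_finsetSum _ fun y _ => continuous_finsetSum _ fun q _ => (hec q y).pow 2)
  have hfun : (fun V => (kerE G r β c b V (fun V => ∑ y ∈ cubeSites c b, v (s • siteToE y) * dens G r y V) -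
        ∑ y ∈ cubeSites c b, v (s • siteToE y) * ∑ q : {q : Fin 4 × Fin 4 // q.1 < q.2}, pq q) ^ 2) =
      fun V => (∑ y ∈ T, v (s • siteToE y) * ∑ q : {q : Fin 4 × Fin 4 // q.1 < q.2}, e q y V) ^ 2 := by
    funext V; rw [hD V]
  rw [hfun]
  have hmono := torusE_mono G r β L
    (A := fun V => (∑ y ∈ T, v (s • siteToE y) * ∑ q : {q : Fin 4 × Fin 4 // q.1 < q.2}, e q y V) ^ 2)
    (B := fun V => 6 * (T.card : ℝ) * K ^ 2 *
      ∑ y ∈ T, ∑ q : {q : Fin 4 × Fin 4 // q.1 < q.2}, e q y V ^ 2) (hDc.pow 2) hRc hpt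
  refine hmono.trans ?_
  have hlin : torusE G r β L (fun V => ∑ y ∈ T, ∑ q : {q : Fin 4 × Fin 4 // q.1 < q.2}, e q y V ^ 2) =
      ∑ y ∈ T, ∑ q : {q : Fin 4 × Fin 4 // q.1 < q.2}, torusE G r β L (fun V => e q y V ^ 2) := by
    rw [torusE_finset_sum G r β L T (fun y V => ∑ q : {q : Fin 4 × Fin 4 // q.1 < q.2}, e q y V ^ 2)
      (fun y _ => continuous_finsetSum _ fun q _ => (hec q y).pow 2)]
    refine Finset.sum_congr rfl fun y _ => ?_
    exact torusE_finset_sum G r β L _ (fun q V => e q y V ^ 2) (fun q _ => (hec q y).pow 2)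
  have hTN : (T.card : ℝ) ≤ N := by exact_mod_cast hN
  have hK0 : 0 ≤ K := (abs_nonneg _).trans (hK 0)
  rw [torusE_const_mul, hlin]
  calc 6 * (T.card : ℝ) * K ^ 2 * ∑ y ∈ T, ∑ q : {q : Fin 4 × Fin 4 // q.1 < q.2},
        torusE G r β L (fun V => e q y V ^ 2)
      ≤ 6 * (T.card : ℝ) * K ^ 2 * ∑ y ∈ T, ∑ _q : {q : Fin 4 × Fin 4 // q.1 < q.2}, h ^ 2 := by
        refine mul_le_mul_of_nonneg_left ?_ (by positivity)
        exact Finset.sum_le_sum fun y hy => Finset.sum_le_sum fun q _ => hterm2 y hy q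
    _ = 36 * (T.card : ℝ) ^ 2 * K ^ 2 * h ^ 2 := by
        simp only [Finset.sum_const, Finset.card_univ, nsmul_eq_mul, hcard6]
        ring
    _ ≤ 36 * (N : ℝ) ^ 2 * K ^ 2 * h ^ 2 := by gcongr
    _ = (N * (K * (6 * h))) ^ 2 := by ring

/-- **The mean-square response of the smearing is bounded UNIFORMLY in the spacing under a typical plane law.**  At
spacing `0 < s ≤ M`: a cube `Q = (c, b)`; a test function `v` with `v z ≠ 0 → ‖z‖ ≤ M` (`M ≥ 1`) and `|v| ≤ K`
(`K ≥ 0`); the `e₀`-thickened lattice support of `v(s·)` in `Q` at depth `≥ κ/s`; per-site MEAN-SQUARE law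
`E_T[(kerE_Q^{lift U}(plane_q y) − p_q)²] ≤ (C₁/depth(y)⁴)²` for every `q` on the thickened support.  Then
`E_T[(kerE_Q(Ṽ) − p_V)²] ≤ (6·7⁴·K·C₁·M⁴/κ⁴)²`: the `s⁻⁴` sites of the support are paid by the `(s/κ)⁴` response.
[folklore] -/
theorem smear_response_sq_le_uniform (β : ℝ) (c : Fin 4 → ℤ) (b L : ℕ) {s M κ C₁ K : ℝ} (hs : 0 < s)
    (hsM : s ≤ M) (hM1 : 1 ≤ M) (hκ : 0 < κ) (hC₁ : 0 ≤ C₁) (hK : 0 ≤ K) (v : 𝓢(EuclideanSpace ℝ (Fin 4), ℝ))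
    (hvM : ∀ z, v z ≠ 0 → ‖z‖ ≤ M) (hvK : ∀ z, |v z| ≤ K)
    (hthick : ∀ x : Fin 4 → ℤ, (v (s • siteToE x) ≠ 0 ∨ v (s • siteToE (x + Pi.single 0 1)) ≠ 0) →
      x ∈ cubeSites c b ∧ κ / s ≤ (depth c b x : ℝ))
    (pq : {q : Fin 4 × Fin 4 // q.1 < q.2} → ℝ)
    (hBL2 : ∀ q : {q : Fin 4 × Fin 4 // q.1 < q.2}, ∀ x ∈ cubeSites c b,
      (v (s • siteToE x) ≠ 0 ∨ v (s • siteToE (x + Pi.single 0 1)) ≠ 0) →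
        torusE G r β L (fun V => (kerE G r β c b V (plane G r q.1 x) - pq q) ^ 2) ≤
          (C₁ / (depth c b x : ℝ) ^ 4) ^ 2) :
    torusE G r β L (fun V => (kerE G r β c b V (fun V => ∑ y ∈ cubeSites c b, v (s • siteToE y) * dens G r y V) -
        ∑ y ∈ cubeSites c b, v (s • siteToE y) * ∑ q : {q : Fin 4 × Fin 4 // q.1 < q.2}, pq q) ^ 2) ≤
      (6 * 7 ^ 4 * K * C₁ * M ^ 4 / κ ^ 4) ^ 2 := by
  classical
  have hh : ∀ q : {q : Fin 4 × Fin 4 // q.1 < q.2}, ∀ y ∈ cubeSites c b, v (s • siteToE y) ≠ 0 →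
      torusE G r β L (fun V => (kerE G r β c b V (plane G r q.1 y) - pq q) ^ 2) ≤ (C₁ * (s / κ) ^ 4) ^ 2 :=
    fun q y hy hv => (hBL2 q y hy (Or.inl hv)).trans (pow_le_pow_left₀ (by positivity)
      (div_pow_depth_le hC₁ hκ hs (hthick y (Or.inl hv)).2) 2)
  set N : ℕ := ⌈M / s⌉₊ + 1 with hN
  have hcount : ((cubeSites c b).filter fun y => v (s • siteToE y) ≠ 0).card ≤ (2 * N + 1) ^ 4 := by
    rw [← card_box 4 N]
    refine Finset.card_le_card fun y hy => ?_
    exact mem_box_of_thickSupport hs hvM y (Or.inl (Finset.mem_filter.1 hy).2)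
  have hmain := smear_response_sq_le G r β c b L s v pq (h := C₁ * (s / κ) ^ 4) (K := K) hh
    (fun y => hvK _) ((2 * N + 1) ^ 4) hcount
  refine hmain.trans (pow_le_pow_left₀ (by positivity) ?_ 2)
  -- arithmetic: `(2N+1)⁴ · K · 6 C₁ (s/κ)⁴ ≤ 6·7⁴ K C₁ M⁴/κ⁴` using `2N + 1 ≤ 7M/s`
  have hNle : ((2 * N + 1 : ℕ) : ℝ) ≤ 7 * M / s := by
    have hceil : (⌈M / s⌉₊ : ℝ) < M / s + 1 := Nat.ceil_lt_add_one (by positivity)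
    have h1 : ((2 * N + 1 : ℕ) : ℝ) = 2 * (⌈M / s⌉₊ : ℝ) + 3 := by rw [hN]; push_cast; ring
    rw [h1, le_div_iff₀ hs]
    have hMs : M / s * s = M := div_mul_cancel₀ M hs.ne'
    nlinarith [hsM, hceil, hMs, hs]
  have hpow : (((2 * N + 1) ^ 4 : ℕ) : ℝ) ≤ (7 * M / s) ^ 4 := by
    push_cast
    have h0 : (0 : ℝ) ≤ ((2 * N + 1 : ℕ) : ℝ) := by positivity
    have := pow_le_pow_left₀ h0 hNle 4
    push_cast at this
    exact this
  have hrhs : (7 * M / s) ^ 4 * (K * (6 * (C₁ * (s / κ) ^ 4))) = 6 * 7 ^ 4 * K * C₁ * M ^ 4 / κ ^ 4 := by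
    field_simp
  calc (((2 * N + 1) ^ 4 : ℕ) : ℝ) * (K * (6 * (C₁ * (s / κ) ^ 4)))
      ≤ (7 * M / s) ^ 4 * (K * (6 * (C₁ * (s / κ) ^ 4))) := mul_le_mul_of_nonneg_right hpow (by positivity)
    _ = 6 * 7 ^ 4 * K * C₁ * M ^ 4 / κ ^ 4 := hrhs

end Smear


end Summit.QuantumFields.YangMills.Cruxes.FiniteRankMirrorDefectPeeling

end
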